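import Mathlib
import HarnessLib
import Literature.MathematicalPhysics.QuantumLattice.KohnLuttinger
import Summits.HubbardSuperconductivity.HubbardSuperconductivity.Theorems.ChiralWindowCwChannelInfContinuousFilling
import Summits.HubbardSuperconductivity.HubbardSuperconductivity.Theorems.KLProgrammeMuOfDopingWindowFillingD020Upper
import Summits.HubbardSuperconductivity.HubbardSuperconductivity.Theorems.KLProgrammeMuOfDopingWindowFillingD010Lower
import Summits.HubbardSuperconductivity.HubbardSuperconductivity.Theorems.WeakCouplingBCSKlCertB1gWindowD010D020

/-!
# Route `WeakCouplingBCS` — support item `WcbcsKohnLuttingerB1g` (stmt-HubbardSuperconductivity-0158):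
# the window certificate in the DOPING variable, `δ ∈ [0.10, 0.20]` (the window of record)

The whole-window theorem `klb1g_window_d010_d020` (records `klCertB1gWin{A,B,C}`, 44 μ-uniform boxes) states `B1g`
dominance for every chemical potential `μ ∈ [-0.42749, -0.1775]`.  The leaf `WcbcsKohnLuttingerB1g` and the programme's
risk register speak the hole doping `δ`, through the free-band chemical potential
`μ(δ) = chemicalPotentialOfDensity ε₀ (1 - δ) = sInf {μ | 1 - δ ≤ n(μ)}`.  The two kernel-checked polygon certificates
`muWinD020_filling_lt : n(-0.42749) < 4/5` and `muWinD010_filling_ge : 9/10 ≤ n(-0.1775)` give, by monotonicity of the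
filling and the `sInf` characterisation (as in `muOfDopingWindow_proof`),
`μ(δ) ∈ [-0.42749, -0.1775]` for every `δ ∈ [0.10, 0.20]` (`muOfDoping_mem_window_d010_d020`, a sharpening of item
`MuOfDopingWindow` on the sub-window), hence the δ-form of the certificate: for every `δ ∈ [0.10, 0.20]`, every
`0 < U < 1` and every `χ ≠ B1g`, `channelInf ε₀ μ(δ) U B1g + γ U² ≤ channelInf ε₀ μ(δ) U χ` with the window margin
`γ = min (min γ_A γ_B) γ_C = 437/16384` — modulo the three named enclosure hypotheses `klCertB1gWin{A,B,C}.EnclosuresB1g`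
(certified outside Lean in two interval implementations, HOME/MU-WINDOW.md of the gate cell `gate-hubbard-kl`).  This
is the matrix of the leaf `WcbcsKohnLuttingerB1g` at the EXPLICIT witnesses `a = 0.10`, `b = 0.20`, `U₁ = 1` (the existential
leaf itself, modulo the same hypotheses, is `wcbcsKohnLuttingerB1g_of_window_d010_d020`).  Folklore glue; no definitions.
-/

noncomputable section

-- the tree's namespace `Summit.<Summit>.<Problem>.Theorems` repeats the summit name by design (D-0017)
set_option linter.dupNamespace false

namespace Summit.HubbardSuperconductivity.HubbardSuperconductivity.Theorems

open Literature.MathematicalPhysics.QuantumLattice CwKLChiralWindow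

/-- **The free-band chemical potentials of the doping window of record lie in the certified μ-window**:
`μ(δ) ∈ [-0.42749, -0.1775]` for every `δ ∈ [0.10, 0.20]` (certified fillings `n(-0.42749) < 4/5`, `n(-0.1775) ≥ 9/10`,
monotonicity of `n`, `sInf` characterisation). [folklore] -/
theorem muOfDoping_mem_window_d010_d020 :
    ∀ δ ∈ Set.Icc (0.10 : ℝ) 0.20,
      chemicalPotentialOfDensity (squareDispersion 1 0) (1 - δ) ∈ Set.Icc (-0.42749 : ℝ) (-0.1775) := by
  intro δ hδ
  obtain ⟨hδ1, hδ2⟩ := hδ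
  set S : Set ℝ := {μ | 1 - δ ≤ KohnLuttinger.filling (squareDispersion 1 0) μ} with hS
  have hdef : chemicalPotentialOfDensity (squareDispersion 1 0) (1 - δ) = sInf S := rfl
  -- every admissible chemical potential is `≥ -0.42749`
  have hlow : ∀ μ ∈ S, -0.42749 ≤ μ := by
    intro μ hμ
    by_contra h
    push Not at h
    have hmono := monotone_filling h.le
    have hlt := muWinD020_filling_lt
    rw [show (-(42749 : ℝ) / 100000) = -0.42749 by norm_num] at hlt
    have hμ' : 1 - δ ≤ KohnLuttinger.filling (squareDispersion 1 0) μ := hμ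
    norm_num at hδ2
    linarith
  -- the energy `-0.1775` is admissible
  have hmem : (-0.1775 : ℝ) ∈ S := by
    show 1 - δ ≤ KohnLuttinger.filling (squareDispersion 1 0) (-0.1775)
    have h := muWinD010_filling_ge
    rw [show (-(71 : ℝ) / 400) = -0.1775 by norm_num] at h
    norm_num at hδ1
    linarith
  rw [hdef]
  exact ⟨le_csInf ⟨_, hmem⟩ hlow, csInf_le ⟨-0.42749, hlow⟩ hmem⟩

/-- **`B1g` (`d_{x²-y²}`) dominance of the second-order Kohn–Luttinger vertex on the DOPING window of record
`δ ∈ [0.10, 0.20]`**, modulo the certified enclosures of the three window records: for every such `δ`, every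
`0 < U < 1` and every `χ ≠ B1g`, at the free-band chemical potential `μ(δ)`,
`channelInf ε₀ μ(δ) U B1g + γ U² ≤ channelInf ε₀ μ(δ) U χ` with `γ = min (min γ_A γ_B) γ_C`.
[cite: RaghuKivelsonScalapino2010, §III Fig. 2] -/
theorem klb1g_doping_window_d010_d020 (hA : klCertB1gWinA.EnclosuresB1g) (hB : klCertB1gWinB.EnclosuresB1g)
    (hC : klCertB1gWinC.EnclosuresB1g) :
    ∀ δ ∈ Set.Icc (0.10 : ℝ) 0.20, ∀ U ∈ Set.Ioo (0 : ℝ) 1, ∀ χ : D4Irrep, χ ≠ D4Irrep.B1g →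
      channelInf (squareDispersion 1 0) (chemicalPotentialOfDensity (squareDispersion 1 0) (1 - δ)) U D4Irrep.B1g +
          min (min ((klCertB1gWinA.gamma : ℚ) : ℝ) ((klCertB1gWinB.gamma : ℚ) : ℝ)) ((klCertB1gWinC.gamma : ℚ) : ℝ) *
            U ^ 2 ≤
        channelInf (squareDispersion 1 0) (chemicalPotentialOfDensity (squareDispersion 1 0) (1 - δ)) U χ := by
  intro δ hδ
  exact klb1g_window_d010_d020 hA hB hC _ (muOfDoping_mem_window_d010_d020 δ hδ)

end Summit.HubbardSuperconductivity.HubbardSuperconductivity.Theorems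

end
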